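import Literature.NumberTheory.GaloisRepresentations.ContinuousCohomologyVanishing
import HarnessLib

/-!
# Coinduced topological representations are acyclic for continuous cohomology

For a locally compact topological group `G` and any topological representation `X : TopRep k G`,
the coinduced representation `coind₁ X = C(G, X)` (`(g • f)(x) = g • f (g⁻¹ x)`, Mathlib
`TopRep.coind₁`) has vanishing continuous cohomology in positive degrees:
`subsingleton_continuousCohomology_coind₁`. This is the statement
"`H^r(G, π_{*1→G} B) = 0` for `r > 0`" of Shatz, *Profinite groups, arithmetic, and geometry*,
Ch. II §2, Thm. 8 (proof of (4)) = Serre, *Cohomologie galoisienne*, I §2.5 (induced modules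
have trivial cohomology), here for Mathlib's (twisted) model `coind₁` of the coinduced module and
for all locally compact groups, with arbitrary topological coefficients.

Proof (Shatz, loc. cit., transposed to homogeneous cochains): the maps
`h : C(G, Rₘ) → Rₘ`, `(h F)(x₁, …, x_m)(y) = F(y, x₁, …, x_m)(y)` (evaluate the coefficient
variable of `C(G, X)` at the extra group variable) form a contracting homotopy of Mathlib's
standard complex `R₀ = C(G, X) → R₁ = C(G, R₀) → ⋯` of `coind₁ X` in positive degrees,
`d (h F) + h (d F) = F` (`d_coindHomotopy_add`), and commute with the `G`-actions, hence
preserve invariant cochains. In Mathlib's iterated-function-space model `h` is defined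
recursively (`coindHomotopy`): `h₀ F = (y ↦ F y y)`, `h_{m+1} F = (x ↦ hₘ (y ↦ F y x))`; local
compactness of `G` makes currying/uncurrying and evaluation continuous.

## References

* S. S. Shatz, *Profinite groups, arithmetic, and geometry*, Ann. of Math. Studies 67 (1972),
  Ch. II §2, Prop. 5 (4) and Thm. 8. [Shatz1972]
* J.-P. Serre, *Cohomologie galoisienne*, 5e éd., Springer LNM 5 (1994; English translation
  *Galois Cohomology*, 1997), I §2.5. [SerreGaloisCohomology1997]
-/

noncomputable section

open CategoryTheory Limits

universe u v

namespace Literature.NumberTheory.GaloisRepresentations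

open TopRep ContRepresentation ContinuousCohomology

variable {k : Type u} [Ring k] [TopologicalSpace k]
variable {G : Type v} [Group G] [TopologicalSpace G] [IsTopologicalGroup G] [LocallyCompactSpace G]

set_option allowUnsafeReducibility true in
attribute [local reducible] CategoryTheory.Functor.mapHomologicalComplex

/-! ### Flipping two group variables -/

section Flip

variable (G)
variable (Z : Type*) [TopologicalSpace Z]

/-- Exchange of the two variables `C(G, C(G, Z)) → C(G, C(G, Z))`, `F ↦ (x ↦ y ↦ F y x)`, as a
continuous map (currying for the locally compact space `G`). [folklore] -/
def flipCM : C(C(G, C(G, Z)), C(G, C(G, Z))) where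
  toFun F := ContinuousMap.curry (F.uncurry.comp ContinuousMap.prodSwap)
  continuous_toFun :=
    ContinuousMap.continuous_curry.comp
      ((ContinuousMap.continuous_precomp _).comp ContinuousMap.continuous_uncurry)

variable {G Z}

omit [Group G] [IsTopologicalGroup G] in
/-- `flipCM F x y = F y x`. [folklore] -/
@[simp] theorem flipCM_apply (F : C(G, C(G, Z))) (x y : G) : flipCM G Z F x y = F y x := rfl

omit [Group G] [IsTopologicalGroup G] in
/-- Flipping a constant two-variable map. [folklore] -/
theorem flipCM_const [AddCommGroup Z] (c : C(G, Z)) (x : G) :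
    flipCM G Z (ContinuousMap.const G c) x = ContinuousMap.const G (c x) := by
  ext y; rfl

end Flip

/-! ### The contracting homotopy -/

variable (X : TopRep.{v} k G)

/-- The diagonal `G → G × G` as a continuous map. [folklore] -/
def diagCM : C(G, G × G) := ⟨fun y => (y, y), by fun_prop⟩

/-- **Contracting homotopy** of the standard complex of `coind₁ X = C(G, X)` in positive
degrees: `hₘ : R_{m+1} = C(G, Rₘ) → Rₘ`, `(hₘ F)(x₁)…(x_m)(y) = F(y)(x₁)…(x_m)(y)`, defined
recursively by `h₀ F = (y ↦ F y y)` and `h_{m+1} F = (x ↦ hₘ (y ↦ F y x))`; a continuous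
`k`-linear map. [cite: Shatz1972, Ch. II §2 Thm. 8 (proof)] -/
def coindHomotopy : (m : ℕ) →
    (resolutionX (coind₁ X) (m + 1) →L[k] resolutionX (coind₁ X) m)
  | 0 =>
    { toFun := fun F : C(G, C(G, X)) => F.uncurry.comp diagCM
      map_add' := fun F F' => by ext y; rfl
      map_smul' := fun c F => by ext y; rfl
      cont := (ContinuousMap.continuous_precomp _).comp ContinuousMap.continuous_uncurry }
  | m + 1 =>
    { toFun := fun F : C(G, C(G, resolutionX (coind₁ X) m)) =>
        (⟨coindHomotopy m, (coindHomotopy m).continuous⟩ :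
          C(resolutionX (coind₁ X) (m + 1), resolutionX (coind₁ X) m)).comp
          (flipCM G (resolutionX (coind₁ X) m) F)
      map_add' := fun F F' => by
        ext x : 1
        change coindHomotopy m (flipCM G _ (F + F') x) =
          coindHomotopy m (flipCM G _ F x) + coindHomotopy m (flipCM G _ F' x)
        rw [← map_add]
        rfl
      map_smul' := fun c F => by
        ext x : 1
        change coindHomotopy m (flipCM G _ (c • F) x) = c • coindHomotopy m (flipCM G _ F x)
        rw [← map_smul]
        rfl
      cont := (ContinuousMap.continuous_postcomp _).comp (flipCM G _).continuous }

/-- `h₀ F y = F y y`. [folklore] -/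
@[simp] theorem coindHomotopy_zero_apply (F : C(G, C(G, X))) (y : G) :
    (coindHomotopy X 0 F : C(G, X)) y = F y y := rfl

/-- `h_{m+1} F x = hₘ (y ↦ F y x)`. [folklore] -/
@[simp] theorem coindHomotopy_succ_apply (m : ℕ) (F : C(G, C(G, resolutionX (coind₁ X) m)))
    (x : G) :
    (coindHomotopy X (m + 1) F : C(G, resolutionX (coind₁ X) m)) x =
      coindHomotopy X m (flipCM G _ F x) := rfl

/-- `hₘ` of a constant function is its value. [folklore] -/
theorem coindHomotopy_const : ∀ (m : ℕ) (r : resolutionX (coind₁ X) m),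
    coindHomotopy X m (ContinuousMap.const G r) = r
  | 0, r => by ext y; rfl
  | m + 1, r => by
    ext x : 1
    rw [coindHomotopy_succ_apply, flipCM_const, coindHomotopy_const m]

/-- The flip of the differential of the standard complex, evaluated (the identity behind the
inductive step of `d_coindHomotopy_add`). [folklore] -/
theorem flipCM_d_succ_succ (m : ℕ) (F : C(G, C(G, resolutionX (coind₁ X) m))) (x : G) :
    flipCM G _ ((d (coind₁ X) (m + 2)).hom F) x =
      ContinuousMap.const G (F x) - F +
        (ContinuousMap.const G (flipCM G _ F x) - (d (coind₁ X) (m + 1)).hom (flipCM G _ F x)) := by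
  ext y : 1
  simp only [flipCM_apply, ContinuousMap.sub_apply, ContinuousMap.add_apply,
    ContinuousMap.const_apply]
  rw [d_succ_hom_apply (coind₁ X) m (flipCM G _ F x) y, flipCM_apply F x y, sub_sub_cancel,
    d_succ_hom_apply (coind₁ X) (m + 1) F y, ContinuousMap.sub_apply,
    d_succ_hom_apply (coind₁ X) m (F y) x]
  abel

/-- **Homotopy identity** `d (hₘ F) + h_{m+1} (d F) = F` on `R_{m+1} = C(G, Rₘ)` for the
standard complex of `coind₁ X`. [cite: Shatz1972, Ch. II §2 Thm. 8 (proof)] -/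
theorem d_coindHomotopy_add : ∀ (m : ℕ) (F : resolutionX (coind₁ X) (m + 1)),
    (d (coind₁ X) m).hom (coindHomotopy X m F) +
      coindHomotopy X (m + 1) ((d (coind₁ X) (m + 1)).hom F) = F
  | 0, F => by
    ext x y
    change (d (coind₁ X) 0).hom (coindHomotopy X 0 F) x y +
      (coindHomotopy X 1 ((d (coind₁ X) 1).hom F) : C(G, C(G, X))) x y = (F : C(G, C(G, X))) x y
    rw [d_zero_hom_apply, coindHomotopy_zero_apply, coindHomotopy_succ_apply,
      coindHomotopy_zero_apply, flipCM_apply, d_succ_hom_apply, ContinuousMap.sub_apply,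
      ContinuousMap.sub_apply, d_zero_hom_apply]
    abel
  | m + 1, F => by
    ext x : 1
    change (d (coind₁ X) (m + 1)).hom (coindHomotopy X (m + 1) F) x +
      (coindHomotopy X (m + 2) ((d (coind₁ X) (m + 2)).hom F) :
        C(G, resolutionX (coind₁ X) (m + 1))) x = F x
    rw [d_succ_hom_apply, coindHomotopy_succ_apply, coindHomotopy_succ_apply, flipCM_d_succ_succ,
      map_add, map_sub, map_sub, coindHomotopy_const, coindHomotopy_const]
    have ih := d_coindHomotopy_add m (flipCM G _ F x)
    rw [← eq_sub_iff_add_eq'] at ih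
    rw [ih]
    change coindHomotopy X (m + 1) F - _ + (F x - coindHomotopy X (m + 1) F + _) = F x
    abel

/-- The homotopy commutes with the `G`-actions of the standard complex. [folklore] -/
theorem coindHomotopy_ρ : ∀ (m : ℕ) (g : G) (F : resolutionX (coind₁ X) (m + 1)),
    coindHomotopy X m ((resolutionX (coind₁ X) (m + 1)).ρ g F) =
      (resolutionX (coind₁ X) m).ρ g (coindHomotopy X m F)
  | 0, g, F => by
    ext y
    rfl
  | m + 1, g, F => by
    ext x : 1
    rw [coindHomotopy_succ_apply, resolutionX_succ_ρ_apply, coindHomotopy_succ_apply,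
      ← coindHomotopy_ρ m g]
    congr 1

/-- **Coinduced representations are acyclic**: for a locally compact group `G` and any
topological representation `X`, `H^{n+1}(G, coind₁ X) = 0` where `coind₁ X = C(G, X)` is
Mathlib's coinduced representation (Shatz II §2 Thm. 8, proof of statement (4) of Prop. 5:
`H^r(G, π_{*1→G} B) = 0` for `r > 0`; Serre I §2.5: induced modules have trivial cohomology).
[cite: Shatz1972, Ch. II §2 Thm. 8] [cite: SerreGaloisCohomology1997, I §2.5] -/
theorem subsingleton_continuousCohomology_coind₁ (n : ℕ) :
    Subsingleton (continuousCohomology (n + 1) (coind₁ X)) := by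
  rw [subsingleton_homology_succ_iff]
  intro σ hσ
  have hσ' : (d (coind₁ X) (n + 2)).hom σ.1 = 0 := by
    have := congrArg Subtype.val hσ
    rwa [cochains_d_coe] at this
  refine ⟨⟨coindHomotopy X (n + 1) σ.1, (mem_invariants _).2 fun g => ?_⟩, Subtype.ext ?_⟩
  · rw [← coindHomotopy_ρ, (mem_invariants _).1 σ.2 g]
  · rw [cochains_d_coe]
    have key := d_coindHomotopy_add X (n + 1) σ.1
    rw [hσ', map_zero, add_zero] at key
    exact key

end Literature.NumberTheory.GaloisRepresentations

end
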